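import Summits.AnomalousDissipation.AnomalousDissipation.Theorems.MirrorStatisticsLoudTG.Negative.LoadBearing
import Literature.Analysis.FunctionSpaces.TorusLineHardy
import Literature.Analysis.ODE.ConstCoeffL2Vanishing
import HarnessLib

/-!
# Stub `stub_oddPoincareK` of line `regimes`, crux `MirrorEnsemble.MirrorStatisticsLoudTG` (stmt-AnomalousDissipation-17693)

LOCAL POINCARÉ INEQUALITY ACROSS A SYMMETRY PLANE OF `T³`. Let `u : T³ → ℝ` be smooth and odd under
the reflection `xᵢ ↦ -xᵢ` of one coordinate, `u (update x i (-x i)) = -u x`. Since `-0 = 0` and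
`-½ = ½` in `ℝ/ℤ`, the reflection fixes the two planes `{xᵢ = 0}` and `{xᵢ = ½}`, so `u` vanishes
there. For a bounded measurable weight `φ ≥ 0` that does not depend on `xᵢ` and a half-width
`0 < a ≤ ¼`, the weighted `L²`-mass of `u` in the slab `{‖xᵢ - c‖ ≤ a}` (`c = 0` or `c = ½`,
`‖·‖` the quotient norm of `ℝ/ℤ`) is controlled by that of `∂ᵢ u` with the factor `a²`:

  `∫_{‖xᵢ - c‖ ≤ a} φ u² ≤ a² ∫_{‖xᵢ - c‖ ≤ a} φ (∂ᵢ u)²`   (`Torus.partialDeriv`, global `volume`).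

This is the analytic heart of the deterministic Kelvin tube inequality of the line (stub T2b takes
the statement verbatim): components of `K`-symmetric fields are odd across the symmetry planes, and
the factor `a²` turns the tube law into a cusp law.

## Proof

* One dimension (`OddPoincareK.intervalIntegral_sq_le`): if `U` has a continuous derivative `U'`
  and `U m = 0`, then `∫_{m-a}^{m+a} U² ≤ a² ∫_{m-a}^{m+a} U'²`. On `[m, m + a]`,
  `U(t)² = (∫ₘᵗ U')² ≤ (t - m) ∫ₘᵗ U'² ≤ a ∫ₘ^{m+a} U'²` (fundamental theorem of calculus and
  Cauchy–Schwarz, the tree's `Literature.Analysis.ODE.sq_intervalIntegral_le`); integrate over a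
  length-`a` interval, and reflect for `[m - a, m]`.
* One line (`OddPoincareK.lintegral_line_slab_eq`): along `τ ↦ x + τ𝐞ᵢ` the weight is the constant
  `φ x`, the line function `τ ↦ u (x + τ𝐞ᵢ)` is smooth with derivative `∂ᵢ u (x + τ𝐞ᵢ)`
  (`Torus.hasDerivAt_comp_add_proj_smul`) and vanishes at `τ = -ξ` for a real lift `ξ` of `xᵢ - c`;
  on the period `(-ξ - ½, -ξ + ½]` the slab is the interval `[-ξ - a, -ξ + a]`
  (`AddCircle.norm_coe_eq_abs_iff`).
* Fubini along the coordinate lines: the shear inequality / identity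
  `∫⁻ Φ ≤ (=) ∫⁻ₓ ∫⁻_{τ ∈ (0,1]} Φ(x + τ𝐞ᵢ)` of `TorusLineHardy`
  (`Torus.lintegral_le_lintegral_lintegral_line`, `Torus.lintegral_lintegral_line_Ioc_eq`), applied to
  the nonnegative integrands as `ℝ≥0∞`-valued functions, then back to Bochner integrals.

Sources: the one-dimensional inequality is folklore (Friedrichs–Poincaré across a zero; cf.
G. H. Hardy, J. E. Littlewood, G. Pólya, *Inequalities* (1952), Ch. VII, Thm. 253 (Hardy's
inequality, which implies it with the constant `4a²`) and Thms. 256–257 (Wirtinger);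
L. C. Evans, *Partial Differential Equations* (2010), §5.8.1). No named facts are used.
-/

-- every `Summit.AnomalousDissipation.AnomalousDissipation.…` name repeats the summit = problem segment (tree layout)
set_option linter.dupNamespace false

noncomputable section

namespace Summit.AnomalousDissipation.AnomalousDissipation.Theorems.MirrorEnsembleMirrorStatisticsLoudTG

open MeasureTheory Filter Topology Set
open scoped ENNReal InnerProductSpace NNReal
open Literature.Analysis.FunctionSpaces Literature.Analysis.FluidPDE
open Summit.AnomalousDissipation.AnomalousDissipation.Theorems.TaylorGreenLoudGalerkinStates.Negative
  (tgForce isSmooth_tgForce isDivFree_tgForce hasZeroMean_tgForce integral_norm_sq_tgForce)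
open Summit.AnomalousDissipation.AnomalousDissipation.Theorems.MirrorStatisticsLoudTG.Negative
  (mirrorClass memLp_tgForce measurePreserving_reflect)

namespace OddPoincareK

/-! ## One dimension: the local Poincaré inequality across a zero -/

/-- One-sided local Poincaré inequality: if `U'` is a continuous derivative of `U` and `U m = 0`,
then `∫ₘ^{m+a} U² ≤ a² ∫ₘ^{m+a} U'²` (`0 ≤ a`): pointwise `U(t)² = (∫ₘᵗ U')² ≤ (t - m) ∫ₘᵗ U'²
≤ a ∫ₘ^{m+a} U'²` (FTC, Cauchy–Schwarz), integrated over `[m, m + a]`. [folklore] -/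
theorem intervalIntegral_sq_le_right {U U' : ℝ → ℝ} (hU : ∀ t, HasDerivAt U (U' t) t)
    (hU' : Continuous U') {m a : ℝ} (ha : 0 ≤ a) (h0 : U m = 0) :
    ∫ t in m..m + a, U t ^ 2 ≤ a ^ 2 * ∫ t in m..m + a, U' t ^ 2 := by
  have hUc : Continuous U := continuous_iff_continuousAt.2 fun t => (hU t).continuousAt
  set J := ∫ t in m..m + a, U' t ^ 2 with hJ
  have hpt : ∀ t ∈ Icc m (m + a), U t ^ 2 ≤ a * J := by
    intro t ht
    have hFTC : U t = ∫ s in m..t, U' s := by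
      rw [intervalIntegral.integral_eq_sub_of_hasDerivAt (fun s _ => hU s) (hU'.intervalIntegrable m t),
        h0, sub_zero]
    have hmono : ∫ s in m..t, U' s ^ 2 ≤ J :=
      intervalIntegral.integral_mono_interval le_rfl ht.1 ht.2
        (Eventually.of_forall fun s => sq_nonneg _) ((hU'.pow 2).intervalIntegrable _ _)
    have hI0 : 0 ≤ ∫ s in m..t, U' s ^ 2 := intervalIntegral.integral_nonneg ht.1 fun s _ => sq_nonneg _
    calc U t ^ 2 = (∫ s in m..t, U' s) ^ 2 := by rw [hFTC]
      _ ≤ (t - m) * ∫ s in m..t, U' s ^ 2 := Literature.Analysis.ODE.sq_intervalIntegral_le hU' ht.1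
      _ ≤ a * J := mul_le_mul (by linarith [ht.2]) hmono hI0 ha
  calc ∫ t in m..m + a, U t ^ 2 ≤ ∫ _ in m..m + a, a * J :=
        intervalIntegral.integral_mono_on (by linarith) ((hUc.pow 2).intervalIntegrable _ _)
          intervalIntegrable_const hpt
    _ = a ^ 2 * J := by rw [intervalIntegral.integral_const, smul_eq_mul]; ring

/-- One-sided local Poincaré inequality to the left of the zero, `∫_{m-a}^m U² ≤ a² ∫_{m-a}^m U'²`
(the right-sided one for `t ↦ U (-t)`, substitution `t ↦ -t`). [folklore] -/
theorem intervalIntegral_sq_le_left {U U' : ℝ → ℝ} (hU : ∀ t, HasDerivAt U (U' t) t)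
    (hU' : Continuous U') {m a : ℝ} (ha : 0 ≤ a) (h0 : U m = 0) :
    ∫ t in m - a..m, U t ^ 2 ≤ a ^ 2 * ∫ t in m - a..m, U' t ^ 2 := by
  have hV : ∀ t, HasDerivAt (fun s => U (-s)) (-U' (-t)) t := fun t => by
    have h : HasDerivAt (fun s => U (-s)) (U' (-t) * -1) t := (hU (-t)).comp t (hasDerivAt_neg t)
    convert h using 1
    ring
  have hV' : Continuous fun t => -U' (-t) := (hU'.comp continuous_neg).neg
  have h := intervalIntegral_sq_le_right hV hV' ha (m := -m) (by simpa using h0)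
  have e1 : ∫ t in -m..-m + a, U (-t) ^ 2 = ∫ t in m - a..m, U t ^ 2 := by
    rw [intervalIntegral.integral_comp_neg (fun t => U t ^ 2), neg_neg,
      show -(-m + a) = m - a by ring]
  have e2 : ∫ t in -m..-m + a, (-U' (-t)) ^ 2 = ∫ t in m - a..m, U' t ^ 2 := by
    simp_rw [neg_sq]
    rw [intervalIntegral.integral_comp_neg (fun t => U' t ^ 2), neg_neg,
      show -(-m + a) = m - a by ring]
  rw [e1, e2] at h
  exact h

/-- **Local Poincaré inequality across a zero.** If `U : ℝ → ℝ` has the continuous derivative `U'`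
and `U m = 0`, then `∫_{m-a}^{m+a} U² ≤ a² ∫_{m-a}^{m+a} U'²` for every `0 ≤ a` (Friedrichs–Poincaré
on an interval with a zero; cf. Hardy–Littlewood–Pólya, *Inequalities*, Ch. VII; Evans, *PDE*,
§5.8.1). [folklore] -/
theorem intervalIntegral_sq_le {U U' : ℝ → ℝ} (hU : ∀ t, HasDerivAt U (U' t) t)
    (hU' : Continuous U') {m a : ℝ} (ha : 0 ≤ a) (h0 : U m = 0) :
    ∫ t in m - a..m + a, U t ^ 2 ≤ a ^ 2 * ∫ t in m - a..m + a, U' t ^ 2 := by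
  have hUc : Continuous U := continuous_iff_continuousAt.2 fun t => (hU t).continuousAt
  have hiU : ∀ α β : ℝ, IntervalIntegrable (fun t => U t ^ 2) volume α β := fun α β =>
    (hUc.pow 2).intervalIntegrable α β
  have hiU' : ∀ α β : ℝ, IntervalIntegrable (fun t => U' t ^ 2) volume α β := fun α β =>
    (hU'.pow 2).intervalIntegrable α β
  rw [← intervalIntegral.integral_add_adjacent_intervals (hiU (m - a) m) (hiU m (m + a)),
    ← intervalIntegral.integral_add_adjacent_intervals (hiU' (m - a) m) (hiU' m (m + a))]
  have h1 := intervalIntegral_sq_le_left hU hU' ha h0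
  have h2 := intervalIntegral_sq_le_right hU hU' ha h0
  calc (∫ t in m - a..m, U t ^ 2) + ∫ t in m..m + a, U t ^ 2
        ≤ a ^ 2 * (∫ t in m - a..m, U' t ^ 2) + a ^ 2 * ∫ t in m..m + a, U' t ^ 2 := add_le_add h1 h2
    _ = a ^ 2 * ((∫ t in m - a..m, U' t ^ 2) + ∫ t in m..m + a, U' t ^ 2) := by ring

/-! ## One coordinate line of the torus -/

/-- The real segment `τ ↦ proj (τ eᵢ)` of `ℝ³` covers the coordinate line `τ ↦ τ𝐞ᵢ` of `T³`
(`𝐞ᵢ τ = Pi.single i (τ : ℝ/ℤ)`). [folklore] -/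
theorem proj_smul_single (i : Fin 3) (τ : ℝ) :
    Torus.proj (τ • EuclideanSpace.single i (1 : ℝ)) =
      (Pi.single i ((τ : ℝ) : UnitAddCircle) : UnitAddTorus (Fin 3)) := by
  funext j
  simp only [Torus.proj_apply, PiLp.smul_apply, smul_eq_mul, Pi.single_apply]
  split_ifs with h <;> simp [h]

/-- Moving along the `i`-th coordinate line changes only the `i`-th coordinate:
`x + t𝐞ᵢ = update x i (x i + t)`. [folklore] -/
theorem add_single_eq_update (x : UnitAddTorus (Fin 3)) (i : Fin 3) (t : UnitAddCircle) :
    x + Pi.single i t = Function.update x i (x i + t) := by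
  funext j
  by_cases h : j = i
  · subst h; simp
  · simp [h]

/-- Along the `i`-th coordinate line a smooth function on `T³` has derivative `∂ᵢ`:
`d/dτ u (x + τ𝐞ᵢ) = ∂ᵢ u (x + τ𝐞ᵢ)` (`Torus.hasDerivAt_comp_add_proj_smul` in the direction `eᵢ`).
[folklore] -/
theorem hasDerivAt_comp_add_single {u : UnitAddTorus (Fin 3) → ℝ} (hu : Torus.IsSmooth u) (i : Fin 3)
    (x : UnitAddTorus (Fin 3)) (τ : ℝ) :
    HasDerivAt (fun s : ℝ => u (x + Pi.single i ((s : ℝ) : UnitAddCircle)))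
      (Torus.partialDeriv i u (x + Pi.single i ((τ : ℝ) : UnitAddCircle))) τ := by
  have h := Torus.hasDerivAt_comp_add_proj_smul (hu.isContDiff (by simp)) x
    (EuclideanSpace.single i (1 : ℝ)) τ
  simp only [proj_smul_single] at h
  exact h

/-- On the fundamental window `|σ| ≤ ½` the quotient norm of `ℝ/ℤ` is the absolute value
(`AddCircle.norm_coe_eq_abs_iff`). [folklore] -/
theorem norm_coe_unitAddCircle_eq_abs {σ : ℝ} (h : |σ| ≤ 2⁻¹) : ‖((σ : ℝ) : UnitAddCircle)‖ = |σ| :=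
  (AddCircle.norm_coe_eq_abs_iff (1 : ℝ) one_ne_zero).2 (by rw [abs_one]; linarith)

/-- **One line, one period.** For a weight `φ` not depending on `xᵢ` with `φ x ≥ 0`, a continuous
`w ≥ 0`, the slab `S = {‖yᵢ - c‖ ≤ a}` of half-width `0 ≤ a < ½` and a real lift `ξ` of `xᵢ - c`,
the integral of `𝟙_S φ w` over one period of the line `τ ↦ x + τ𝐞ᵢ` equals
`φ x ∫_{-ξ-a}^{-ξ+a} w (x + τ𝐞ᵢ) dτ`: on the period `(-ξ - ½, -ξ + ½]` one has
`‖(x + τ𝐞ᵢ)ᵢ - c‖ = |ξ + τ|`. [folklore] -/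
theorem lintegral_line_slab_eq (i : Fin 3) (c : UnitAddCircle) {a : ℝ} (ha0 : 0 ≤ a) (ha : a < 2⁻¹)
    {φ w : UnitAddTorus (Fin 3) → ℝ}
    (hφ : ∀ (y : UnitAddTorus (Fin 3)) (t : UnitAddCircle), φ (Function.update y i t) = φ y)
    (hw : Continuous w) (hw0 : ∀ y, 0 ≤ w y) (x : UnitAddTorus (Fin 3)) (hφ0 : 0 ≤ φ x) {ξ : ℝ}
    (hξ : ((ξ : ℝ) : UnitAddCircle) = x i - c) :
    ∫⁻ τ in Ioc (0 : ℝ) 1, {y : UnitAddTorus (Fin 3) | ‖y i - c‖ ≤ a}.indicator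
        (fun y => ENNReal.ofReal (φ y * w y)) (x + Pi.single i ((τ : ℝ) : UnitAddCircle)) =
      ENNReal.ofReal (φ x *
        ∫ τ in (-ξ - a)..(-ξ + a), w (x + Pi.single i ((τ : ℝ) : UnitAddCircle))) := by
  have hLi : ∀ τ : ℝ, (x + (Pi.single i ((τ : ℝ) : UnitAddCircle) : UnitAddTorus (Fin 3))) i - c =
      ((ξ + τ : ℝ) : UnitAddCircle) := by
    intro τ
    rw [AddCircle.coe_add, hξ, Pi.add_apply, Pi.single_eq_same]
    abel
  have hφL : ∀ τ : ℝ, φ (x + Pi.single i ((τ : ℝ) : UnitAddCircle)) = φ x := fun τ => by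
    rw [add_single_eq_update, hφ]
  -- Step 1: move to the period centred at `-ξ`
  rw [← Torus.lintegral_Ioc_line_eq i _ x (-ξ - 2⁻¹)]
  -- Step 2: along this period the slab is the real interval `[-ξ - a, -ξ + a]`
  have hpt : EqOn
      (fun τ : ℝ => {y : UnitAddTorus (Fin 3) | ‖y i - c‖ ≤ a}.indicator
        (fun y => ENNReal.ofReal (φ y * w y)) (x + Pi.single i ((τ : ℝ) : UnitAddCircle)))
      (fun τ : ℝ => (Icc (-ξ - a) (-ξ + a)).indicator
        (fun τ : ℝ => ENNReal.ofReal (φ x * w (x + Pi.single i ((τ : ℝ) : UnitAddCircle)))) τ)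
      (Ioc (-ξ - 2⁻¹) (-ξ - 2⁻¹ + 1)) := by
    intro τ hτ
    have hnorm :
        ‖(x + (Pi.single i ((τ : ℝ) : UnitAddCircle) : UnitAddTorus (Fin 3))) i - c‖ = |ξ + τ| := by
      rw [hLi]
      exact norm_coe_unitAddCircle_eq_abs (abs_le.2 ⟨by linarith [hτ.1], by linarith [hτ.2]⟩)
    have hmem :
        x + Pi.single i ((τ : ℝ) : UnitAddCircle) ∈ {y : UnitAddTorus (Fin 3) | ‖y i - c‖ ≤ a} ↔
          τ ∈ Icc (-ξ - a) (-ξ + a) := by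
      rw [mem_setOf_eq, hnorm, abs_le, mem_Icc]
      constructor <;> rintro ⟨h1, h2⟩ <;> constructor <;> linarith
    simp only
    by_cases hτS : τ ∈ Icc (-ξ - a) (-ξ + a)
    · rw [indicator_of_mem (hmem.2 hτS), indicator_of_mem hτS, hφL]
    · rw [indicator_of_notMem (fun h => hτS (hmem.1 h)), indicator_of_notMem hτS]
  rw [setLIntegral_congr_fun measurableSet_Ioc hpt, lintegral_indicator measurableSet_Icc,
    Measure.restrict_restrict measurableSet_Icc,
    inter_eq_left.2 ((Icc_subset_Ioc_iff (by linarith)).2 ⟨by linarith, by linarith⟩)]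
  -- Step 3: a Bochner integral of a nonnegative continuous function
  have hcontL : Continuous fun τ : ℝ => x + Pi.single i ((τ : ℝ) : UnitAddCircle) :=
    continuous_const.add ((continuous_single i).comp continuous_quotient_mk')
  have hint : Integrable (fun τ : ℝ => φ x * w (x + Pi.single i ((τ : ℝ) : UnitAddCircle)))
      (volume.restrict (Icc (-ξ - a) (-ξ + a))) :=
    (continuous_const.mul (hw.comp hcontL)).integrableOn_Icc
  rw [← ofReal_integral_eq_lintegral_ofReal hint
      (Eventually.of_forall fun τ => mul_nonneg hφ0 (hw0 _)),
    integral_Icc_eq_integral_Ioc, ← intervalIntegral.integral_of_le (by linarith),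
    intervalIntegral.integral_const_mul]

/-- **The per-line inequality.** If moreover `u` is smooth and vanishes on the plane `{yᵢ = c}`,
then over one period of every coordinate line `τ ↦ x + τ𝐞ᵢ`,
`∫ 𝟙_S φ u² ≤ a² ∫ 𝟙_S φ (∂ᵢu)²` (`S = {‖yᵢ - c‖ ≤ a}`, `0 < a ≤ ¼`): the one-dimensional
inequality `intervalIntegral_sq_le` for `τ ↦ u (x + τ𝐞ᵢ)`, which vanishes at `τ = -ξ`. [folklore] -/
theorem lintegral_line_slab_le (i : Fin 3) (c : UnitAddCircle) {a : ℝ} (ha : 0 < a) (ha' : a ≤ 4⁻¹)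
    {u φ : UnitAddTorus (Fin 3) → ℝ} (hu : Torus.IsSmooth u)
    (hu0 : ∀ y : UnitAddTorus (Fin 3), y i = c → u y = 0) (hφ0 : ∀ x, 0 ≤ φ x)
    (hφ : ∀ (y : UnitAddTorus (Fin 3)) (t : UnitAddCircle), φ (Function.update y i t) = φ y)
    (x : UnitAddTorus (Fin 3)) :
    ∫⁻ τ in Ioc (0 : ℝ) 1, {y : UnitAddTorus (Fin 3) | ‖y i - c‖ ≤ a}.indicator
        (fun y => ENNReal.ofReal (φ y * u y ^ 2)) (x + Pi.single i ((τ : ℝ) : UnitAddCircle)) ≤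
      ENNReal.ofReal (a ^ 2) *
        ∫⁻ τ in Ioc (0 : ℝ) 1, {y : UnitAddTorus (Fin 3) | ‖y i - c‖ ≤ a}.indicator
          (fun y => ENNReal.ofReal (φ y * Torus.partialDeriv i u y ^ 2))
            (x + Pi.single i ((τ : ℝ) : UnitAddCircle)) := by
  obtain ⟨ξ, hξ⟩ : ∃ ξ : ℝ, ((ξ : ℝ) : UnitAddCircle) = x i - c := QuotientAddGroup.mk_surjective _
  have ha2 : a < 2⁻¹ := by linarith
  have huc : Continuous u := hu.continuous
  have hduc : Continuous (Torus.partialDeriv i u) := (hu.partialDeriv i).continuous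
  rw [lintegral_line_slab_eq i c ha.le ha2 hφ (huc.pow 2) (fun y => sq_nonneg _) x (hφ0 x) hξ
      (w := fun y => u y ^ 2),
    lintegral_line_slab_eq i c ha.le ha2 hφ (hduc.pow 2) (fun y => sq_nonneg _) x (hφ0 x) hξ
      (w := fun y => Torus.partialDeriv i u y ^ 2),
    ← ENNReal.ofReal_mul (sq_nonneg a)]
  refine ENNReal.ofReal_le_ofReal ?_
  -- the line function vanishes at `τ = -ξ`, where the line crosses the plane `{yᵢ = c}`
  have h0 : u (x + Pi.single i ((-ξ : ℝ) : UnitAddCircle)) = 0 := by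
    refine hu0 _ ?_
    rw [Pi.add_apply, Pi.single_eq_same, AddCircle.coe_neg, hξ]
    abel
  have hcontL : Continuous fun τ : ℝ => x + Pi.single i ((τ : ℝ) : UnitAddCircle) :=
    continuous_const.add ((continuous_single i).comp continuous_quotient_mk')
  have h1D := intervalIntegral_sq_le (hasDerivAt_comp_add_single hu i x) (hduc.comp hcontL) ha.le h0
  calc φ x * ∫ τ in (-ξ - a)..(-ξ + a), u (x + Pi.single i ((τ : ℝ) : UnitAddCircle)) ^ 2
      ≤ φ x * (a ^ 2 * ∫ τ in (-ξ - a)..(-ξ + a),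
          Torus.partialDeriv i u (x + Pi.single i ((τ : ℝ) : UnitAddCircle)) ^ 2) :=
        mul_le_mul_of_nonneg_left h1D (hφ0 x)
    _ = a ^ 2 * (φ x * ∫ τ in (-ξ - a)..(-ξ + a),
          Torus.partialDeriv i u (x + Pi.single i ((τ : ℝ) : UnitAddCircle)) ^ 2) := by ring

/-! ## The slab inequality on the torus -/

/-- **Local Poincaré inequality in a slab of `T³`.** Let `u` be smooth and vanish on the plane
`{xᵢ = c}`, and let `φ ≥ 0` be bounded, measurable and independent of `xᵢ`. Then for `0 < a ≤ ¼`,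
`∫_{‖xᵢ - c‖ ≤ a} φ u² ≤ a² ∫_{‖xᵢ - c‖ ≤ a} φ (∂ᵢ u)²`: Fubini along the coordinate lines
(`Torus.lintegral_le_lintegral_lintegral_line`, `Torus.lintegral_lintegral_line_Ioc_eq`) of the
per-line inequality `lintegral_line_slab_le`. [folklore] -/
theorem setIntegral_slab_le (i : Fin 3) (c : UnitAddCircle) {a : ℝ} (ha : 0 < a) (ha' : a ≤ 4⁻¹)
    {u φ : UnitAddTorus (Fin 3) → ℝ} (hu : Torus.IsSmooth u)
    (hu0 : ∀ y : UnitAddTorus (Fin 3), y i = c → u y = 0) (hφm : Measurable φ)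
    (hφ0 : ∀ x, 0 ≤ φ x) (hφB : ∃ B : ℝ, ∀ x, φ x ≤ B)
    (hφ : ∀ (y : UnitAddTorus (Fin 3)) (t : UnitAddCircle), φ (Function.update y i t) = φ y) :
    ∫ x in {x : UnitAddTorus (Fin 3) | ‖x i - c‖ ≤ a}, φ x * u x ^ 2 ≤
      a ^ 2 * ∫ x in {x : UnitAddTorus (Fin 3) | ‖x i - c‖ ≤ a},
        φ x * Torus.partialDeriv i u x ^ 2 := by
  obtain ⟨B, hB⟩ := hφB
  have hSm : MeasurableSet {x : UnitAddTorus (Fin 3) | ‖x i - c‖ ≤ a} :=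
    (isClosed_le ((continuous_apply i).sub continuous_const).norm continuous_const).measurableSet
  have huc : Continuous u := hu.continuous
  have hduc : Continuous (Torus.partialDeriv i u) := (hu.partialDeriv i).continuous
  have hφae : ∀ᵐ x ∂(volume : Measure (UnitAddTorus (Fin 3))), ‖φ x‖ ≤ B :=
      Eventually.of_forall fun x => by
    rw [Real.norm_eq_abs, abs_of_nonneg (hφ0 x)]
    exact hB x
  -- the two integrands are nonnegative and integrable
  have hFi : Integrable (fun x => φ x * u x ^ 2) (volume : Measure (UnitAddTorus (Fin 3))) :=
    ((huc.pow 2).integrable_unitAddTorus).bdd_mul hφm.aestronglyMeasurable hφae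
  have hF'i : Integrable (fun x => φ x * Torus.partialDeriv i u x ^ 2)
      (volume : Measure (UnitAddTorus (Fin 3))) :=
    ((hduc.pow 2).integrable_unitAddTorus).bdd_mul hφm.aestronglyMeasurable hφae
  have hF0 : ∀ x, 0 ≤ φ x * u x ^ 2 := fun x => mul_nonneg (hφ0 x) (sq_nonneg _)
  have hF'0 : ∀ x, 0 ≤ φ x * Torus.partialDeriv i u x ^ 2 := fun x =>
    mul_nonneg (hφ0 x) (sq_nonneg _)
  -- pass to `ℝ≥0∞`-valued integrals of indicators
  rw [integral_eq_lintegral_of_nonneg_ae (Eventually.of_forall hF0) hFi.aestronglyMeasurable.restrict,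
    integral_eq_lintegral_of_nonneg_ae (Eventually.of_forall hF'0) hF'i.aestronglyMeasurable.restrict,
    ← lintegral_indicator hSm, ← lintegral_indicator hSm]
  have hG'm : AEMeasurable ({x : UnitAddTorus (Fin 3) | ‖x i - c‖ ≤ a}.indicator fun x =>
      ENNReal.ofReal (φ x * Torus.partialDeriv i u x ^ 2)) (volume : Measure (UnitAddTorus (Fin 3))) :=
    (((hφm.mul (hduc.measurable.pow_const 2)).ennreal_ofReal).indicator hSm).aemeasurable
  -- Fubini along the `i`-th coordinate lines (`calc` is avoided: its `Trans` elaboration times out)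
  have key : ∫⁻ x, {x : UnitAddTorus (Fin 3) | ‖x i - c‖ ≤ a}.indicator
        (fun x => ENNReal.ofReal (φ x * u x ^ 2)) x ≤
      ENNReal.ofReal (a ^ 2) * ∫⁻ x, {x : UnitAddTorus (Fin 3) | ‖x i - c‖ ≤ a}.indicator
        (fun x => ENNReal.ofReal (φ x * Torus.partialDeriv i u x ^ 2)) x := by
    refine (Torus.lintegral_le_lintegral_lintegral_line i _).trans ?_
    refine (lintegral_mono fun x => lintegral_line_slab_le i c ha ha' hu hu0 hφ0 hφ x).trans
      (le_of_eq ?_)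
    rw [lintegral_const_mul' _ _ ENNReal.ofReal_ne_top, Torus.lintegral_lintegral_line_Ioc_eq i hG'm]
  -- the right-hand side is finite
  have hfin : ENNReal.ofReal (a ^ 2) * ∫⁻ x, {x : UnitAddTorus (Fin 3) | ‖x i - c‖ ≤ a}.indicator
      (fun x => ENNReal.ofReal (φ x * Torus.partialDeriv i u x ^ 2)) x ≠ ∞ := by
    refine ENNReal.mul_ne_top ENNReal.ofReal_ne_top ?_
    rw [lintegral_indicator hSm]
    exact ((setLIntegral_le_lintegral _ _).trans_lt
      ((hasFiniteIntegral_iff_ofReal (Eventually.of_forall hF'0)).1 hF'i.hasFiniteIntegral)).ne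
  refine (ENNReal.toReal_mono hfin key).trans_eq ?_
  rw [ENNReal.toReal_mul, ENNReal.toReal_ofReal (sq_nonneg a)]

/-- In `ℝ/ℤ`, `-½ = ½`. [folklore] -/
theorem neg_coe_half : -((2⁻¹ : ℝ) : UnitAddCircle) = ((2⁻¹ : ℝ) : UnitAddCircle) := by
  rw [neg_eq_iff_add_eq_zero, ← AddCircle.coe_add, show (2⁻¹ : ℝ) + 2⁻¹ = 1 by norm_num]
  exact AddCircle.coe_period 1

/-- A function odd under `xᵢ ↦ -xᵢ` vanishes on every plane `{xᵢ = c}` fixed by the reflection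
(`-c = c`): there `update x i (-x i) = x`, so `u x = -u x`. [folklore] -/
theorem eq_zero_of_odd {u : UnitAddTorus (Fin 3) → ℝ} {i : Fin 3}
    (hodd : ∀ x : UnitAddTorus (Fin 3), u (Function.update x i (-x i)) = -u x)
    {c : UnitAddCircle} (hc : -c = c) (y : UnitAddTorus (Fin 3)) (hy : y i = c) : u y = 0 := by
  have h := hodd y
  rw [hy, hc, ← hy, Function.update_eq_self] at h
  linarith

end OddPoincareK

/-- **T2a `stub_oddPoincareK`** — LOCAL POINCARÉ ACROSS A SYMMETRY PLANE on `T³`. Let `u` be smooth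
and odd under the reflection `xᵢ ↦ -xᵢ` (so `u = 0` on the planes `{xᵢ = 0}` and `{xᵢ = ½}`, both
fixed since `-½ = ½` in `ℝ/ℤ`), and let `φ ≥ 0` be bounded, measurable and independent of `xᵢ`. Then
for `0 < a ≤ ¼` the weighted mass of `u` in each of the slabs `{‖xᵢ‖ ≤ a}`, `{‖xᵢ - ½‖ ≤ a}` is at
most `a²` times that of `∂ᵢ u`:
`∫_{slab} φ u² ≤ a² ∫_{slab} φ (∂ᵢu)²` (one-dimensional Friedrichs–Poincaré across a zero on every
coordinate line, `U(t)² ≤ |t| |∫₀ᵗ U'²|`, integrated with the `xᵢ`-independent weight by Fubini along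
the lines; cf. Hardy–Littlewood–Pólya, *Inequalities*, Ch. VII; Evans, *PDE*, §5.8.1). [folklore] -/
theorem stub_oddPoincareK :
    ∀ (i : Fin 3) (a : ℝ) (u φ : UnitAddTorus (Fin 3) → ℝ), 0 < a → a ≤ 4⁻¹ → Torus.IsSmooth u →
      (∀ x, u (Function.update x i (-x i)) = -u x) → Measurable φ → (∀ x, 0 ≤ φ x) →
      (∃ B : ℝ, ∀ x, φ x ≤ B) → (∀ (x : UnitAddTorus (Fin 3)) (t : UnitAddCircle), φ (Function.update x i t) = φ x) →
      (∫ x in {x : UnitAddTorus (Fin 3) | ‖x i‖ ≤ a}, φ x * u x ^ 2 ≤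
          a ^ 2 * ∫ x in {x : UnitAddTorus (Fin 3) | ‖x i‖ ≤ a}, φ x * Torus.partialDeriv i u x ^ 2) ∧
      (∫ x in {x : UnitAddTorus (Fin 3) | ‖x i - ((2⁻¹ : ℝ) : UnitAddCircle)‖ ≤ a}, φ x * u x ^ 2 ≤
          a ^ 2 * ∫ x in {x : UnitAddTorus (Fin 3) | ‖x i - ((2⁻¹ : ℝ) : UnitAddCircle)‖ ≤ a},
            φ x * Torus.partialDeriv i u x ^ 2) := by
  intro i a u φ ha ha' hu hodd hφm hφ0 hφB hφ
  refine ⟨?_, OddPoincareK.setIntegral_slab_le i _ ha ha' hu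
    (OddPoincareK.eq_zero_of_odd hodd OddPoincareK.neg_coe_half) hφm hφ0 hφB hφ⟩
  have h := OddPoincareK.setIntegral_slab_le i 0 ha ha' hu
    (OddPoincareK.eq_zero_of_odd hodd neg_zero) hφm hφ0 hφB hφ
  simpa only [sub_zero] using h

end Summit.AnomalousDissipation.AnomalousDissipation.Theorems.MirrorEnsembleMirrorStatisticsLoudTG

end
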